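import Literature.MathematicalPhysics.QuantumFieldTheory.Balaban1983to89.B10Thm2Exactness
import Literature.MathematicalPhysics.QuantumFieldTheory.Balaban1983to89.B10SectAGathering
import Literature.MathematicalPhysics.QuantumFieldTheory.Balaban1983to89.TreeLengthTorus

/-!
# `Balaban3D.Proofs.ZtermOldOutside` — [B10] p. 272 (exactness sentence of Thm 2) and (36)/(41) «O(log g_j⁻¹)|Z_j|»:
# the step leaves `OldOutside` and `ZtermSucc` of LQB's `B10SectAGathering` for ANY carrier, the first KNITTED to
# LQB's all-scales bound `B10Thm2Exactness.oldOutside_allScales_of_bound25`, the second reduced to the RECURSION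
# by which a concrete carrier defines its Z-terms (with a k-uniform majorant of the gathered constant)

Lane «pub-balaban3d» (HOME `run/shared/lean/pub/pub-balaban3d/`), seat p5 (PLAN.md §3.1 p5: «targets leaves …
`OldOutside`, `ZtermSucc` for `run3`»).  Kernel bookkeeping only; no definition, no named fact; every analytic input is
a binder.  Carrier-parametric over `T : B10.TowerRun`, `P : StepPieces T k`; instantiation at `run3` (p1) is one line
per theorem once the carrier defines `Pold`/`PoldIn` as the printed sums and `Zterm` by the printed recursion.

THE PRINTED TEXT (renders read as images, `…/1985-cmp102-uv-stability-3d-p018-x2.png`, `…-p011/p012-x2.png`).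
* p. 272 = PDF 18 L28–31: «Thus we have estimated ρ_{k+1} by an expression which is almost equal to the right-hand side
  of the inductive assumption (41) for k + 1. To get the exact inequality we estimate a sum of all terms 𝒫_j(Y_j, U_{k+1})
  with localizations Y_j not contained in Ω_{k+1} by O(1)|Λ_k|, or by O(1)|Z_k|.»
* (36) p. 265 = PDF 11: «… + O(log g₀⁻¹)|Ω₁ᶜ| + O(ε^{3+κ₀})|T₁|»; (41) p. 266 = PDF 12 L19–21: «… + Σ_{j=0}^{k−1}
  O(log g_j⁻¹)|Z_j| + Σ_{j=0}^{k−1} O((Lʲε)^{3+κ₀})|T₁^{(j)}|»; p. 271 = PDF 17 L13: «Complementing the constants in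
  (55) to the full lattice T^{(k)}, and gathering together all the transformations and estimates, we obtain the
  inductive inequality (41) for k replaced by k + 1».

TARGET FIELD TYPES (LQB `B10SectAGathering.lean`): `OldOutside P C` l.451–452 «∀ h U, |P.Pold h U − P.PoldIn h U| ≤
C * P.Zvol h» (= `StepLeaves.oldOutside` l.605); `ZtermSucc P CZ` l.476–477 «∀ h, T.Zterm k (P.proj h) + CZ * P.Zvol h
≤ T.Zterm (k+1) h» (= `StepLeaves.ztermSucc` l.608 with CZ = (Cz + Cv)·g_k + C₅ + C₆ + (|log σ₀| + d(𝔤)·log g_k⁻¹)·c₁).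

WHAT IS PROVED.
* `oldOutside_mono`, `ztermSucc_mono` — monotonicity in the constant (|Z_k| ≥ 0).
* `oldOutside_of_allScales` — p. 272 for ANY carrier: if `Pold h U` / `PoldIn h U` ARE the all-scales sums
  `Σ_{j=1}^{k} Σ_{Y} 𝒫_j(Y, U)` / `Σ_{j=1}^{k} Σ_{Y ⊂ Ω_j(h)} 𝒫_j(Y, U)` over LQB one-scale polymer systems (cube carriers
  of `B12TreeDecay`, wall-degree ≤ Δ, volume leaf c₀), with the (44)–(45) smallness in the (25)-type decay and the block
  counts `#(j-blocks ∖ Ω_j(h)) ≤ (M₁Lʲη)⁻³|Z_k|`, then `OldOutside P (C·K₀(c₀,Δ)·CM²·M₁⁻³·(L/(L−1))·(g p(g))²)` —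
  LQB's `B10Thm2Exactness.oldOutside_allScales_of_bound25` BY NAME plus `|Σ_j a_j − Σ_j b_j| ≤ Σ_j |a_j − b_j|`.
* `oldOutside_torus` — the same with every scale-j system LQB's concrete 3-torus block system `tcubeSys 3 (N j)`
  (N j big blocks of the Lʲη-lattice per direction): the carrier leaves are LQB theorems (Δ = 6, c₀ = 32).
* `ztermSucc_of_recursion` — if the carrier's Z-terms obey `Zterm (k+1) h ≥ Zterm k (proj h) + CZ′·|Z_k|(h)` with
  `CZ ≤ CZ′` then `ZtermSucc P CZ`; `gathered_le_majorant` — the gathered constant of `StepLeaves.ztermSucc` is at most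
  the k-UNIFORM form `a + b·log g_k⁻¹` with `a = Cz + Cv + C₅ + C₆ + σmax·c₁`, `b = dg·c₁` once `0 < g_k ≤ 1`,
  `|log σ₀| ≤ σmax`, `d(𝔤) ≤ dg`, `0 ≤ c₁`, `0 ≤ Cz + Cv` (the printed «O(log g_j⁻¹)»: one pair (a, b) for the family);
  `ztermSucc_of_recursion_majorant` — the two combined: a carrier defining `Zterm (k+1) h := Zterm k (proj h) +
  (a + b·log g_k⁻¹)·|Z_k|(h)` satisfies the `StepLeaves` Z-term leaf.
[cite: Balaban1985UV3, Thm 2 proof p.272 + (36) p.265 + (41) p.266]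
-/

open scoped BigOperators

namespace Summit.QuantumFields.Balaban3D.Proofs

open Literature.MathematicalPhysics.QuantumFieldTheory.Balaban1983to89
open Literature.MathematicalPhysics.QuantumFieldTheory.Balaban1983to89.B10 (TowerRun)
open Literature.MathematicalPhysics.QuantumFieldTheory.Balaban1983to89.B10SectAGathering
  (StepPieces OldOutside ZtermSucc)
open Literature.MathematicalPhysics.QuantumFieldTheory.Balaban1983to89.B12TreeDecay (CubeSystem kappa₀ K₀ K₀_pos)

variable {T : TowerRun} {k : ℕ}

/-! ## §1 Monotonicity in the constants -/

/-- `OldOutside P C → C ≤ C' → OldOutside P C'` (|Z_k| ≥ 0). [folklore] -/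
theorem oldOutside_mono {P : StepPieces T k} {C C' : ℝ} (h : OldOutside P C) (hle : C ≤ C') : OldOutside P C' :=
  fun hh U => (h hh U).trans (mul_le_mul_of_nonneg_right hle (P.Zvol_nonneg hh))

/-- `ZtermSucc P CZ' → CZ ≤ CZ' → ZtermSucc P CZ` (|Z_k| ≥ 0). [folklore] -/
theorem ztermSucc_mono {P : StepPieces T k} {CZ CZ' : ℝ} (h : ZtermSucc P CZ') (hle : CZ ≤ CZ') :
    ZtermSucc P CZ := fun hh => by
  have h1 : CZ * P.Zvol hh ≤ CZ' * P.Zvol hh := mul_le_mul_of_nonneg_right hle (P.Zvol_nonneg hh)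
  have h2 := h hh
  linarith

/-! ## §2 p. 272: `OldOutside` knitted to LQB's all-scales bound -/

section Old

variable {Δ : ℕ} {c₀ κ C L M₁ CM g pg : ℝ}

/-- **p. 272 L28–31 for ANY carrier** («we estimate a sum of all terms 𝒫_j(Y_j, U_{k+1}) with localizations Y_j not
contained in Ω_{k+1} by O(1)|Λ_k|, or by O(1)|Z_k|»): suppose the carrier's old interaction terms ARE the printed
sums — `Pold h U = Σ_{j=1}^{k} Σ_Y 𝒫_j(h; Y, U)` (all scale-j localizations, (41) p. 266) and `PoldIn h U = Σ_{j=1}^{k}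
Σ_{Y ⊂ Ω_j(h)} 𝒫_j(h; Y, U)` (those inside the scale-j blocks `Ω_j(h)` of Ω_{k+1}) — over LQB one-scale polymer systems
(`S j`, `G j`: wall-degree ≤ Δ, volume leaf c₀, `κ ≥ κ₀(c₀,Δ)`), with the (44)–(45) smallness inside the (25)-type
decay (`|𝒫_j(h; Y, U)| ≤ C·(CM·g·p(g))²(Lʲη)⁴e^{−κ𝓛(Y)}`, `ℓ j = Lʲη = L^{j−k}`) and the block counts
`#(j-blocks ∖ Ω_j(h)) ≤ (M₁Lʲη)⁻³·|Z_k|(h)`.  Then `OldOutside P (C·K₀(c₀,Δ)·CM²·M₁⁻³·(L/(L−1))·(g·p(g))²)` — LQB's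
`B10Thm2Exactness.oldOutside_allScales_of_bound25` by name, then the triangle inequality over j.  (`g`, `pg` are
whatever smallness parameters the (44) bound is stated with — print: g_{k}, p(g_{k}); a family-uniform majorant is
applied afterwards with `oldOutside_mono`.) [cite: Balaban1985UV3, Thm 2 proof p.272 + (44)–(46) p.267] -/
theorem oldOutside_of_allScales (P : StepPieces T k) (S : ℕ → LocDomainSys) (G : ∀ j, CubeSystem (S j))
    (act : T.Hist (k + 1) → ∀ j, (S j).Dom → T.Cfg (k + 1) → ℝ)
    (Ω : T.Hist (k + 1) → ∀ j, Finset (G j).Cube) (ℓ : ℕ → ℝ)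
    (hL : 1 < L) (hM : 0 < M₁) (hC : 0 ≤ C)
    (hℓ : ∀ j ∈ Finset.Icc 1 k, ℓ j = L⁻¹ ^ (k - j))
    (hΔ : ∀ j ∈ Finset.Icc 1 k, (G j).DegreeLE Δ) (hV : ∀ j ∈ Finset.Icc 1 k, (G j).VolumeLeaf c₀)
    (hκ : kappa₀ c₀ Δ ≤ κ)
    (h25 : ∀ (h : T.Hist (k + 1)), ∀ j ∈ Finset.Icc 1 k,
      B10.Bound25Printed ⟨(S j).Dom, T.Cfg (k + 1), (S j).dj, act h j⟩ ((CM * g * pg) ^ 2 * ℓ j ^ 4) κ C)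
    (hcard : ∀ (h : T.Hist (k + 1)), ∀ j ∈ Finset.Icc 1 k,
      (((Finset.univ : Finset (G j).Cube) \ Ω h j).card : ℝ) ≤ (M₁ * ℓ j)⁻¹ ^ 3 * P.Zvol h)
    (hPold : ∀ (h : T.Hist (k + 1)) (U : T.Cfg (k + 1)),
      P.Pold h U = ∑ j ∈ Finset.Icc 1 k, ∑ X : (S j).Dom, act h j X U)
    (hPoldIn : ∀ (h : T.Hist (k + 1)) (U : T.Cfg (k + 1)),
      P.PoldIn h U = ∑ j ∈ Finset.Icc 1 k,
        ∑ X ∈ Finset.univ.filter (fun X : (S j).Dom => (G j).cubes X ⊆ Ω h j), act h j X U) :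
    OldOutside P (C * K₀ c₀ Δ * CM ^ 2 * M₁⁻¹ ^ 3 * (L / (L - 1)) * (g * pg) ^ 2) := by
  intro h U
  rw [hPold h U, hPoldIn h U, ← Finset.sum_sub_distrib]
  refine (Finset.abs_sum_le_sum_abs _ _).trans ?_
  have hmain := B10Thm2Exactness.oldOutside_allScales_of_bound25 (Cfg := T.Cfg (k + 1)) k S G (act h) U (Ω h) ℓ
    hL hM hC (P.Zvol_nonneg h) hℓ hΔ hV hκ (h25 h) (hcard h)
  exact hmain.trans (le_of_eq (by ring))

/-- **p. 272 on the 3-torus block carriers**: every scale-j polymer system is LQB's periodic block system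
`tcubeSys 3 (N j)` (N j big blocks per direction at scale j; wall-degree ≤ 6 and the volume leaf c₀ = 32 are the LQB
theorems `tdegreeLE`, `tvolumeLeaf`), so only the 𝔇-data hypotheses of `oldOutside_of_allScales` remain.
[cite: Balaban1985UV3, Thm 2 proof p.272 + (44)–(46) p.267] -/
theorem oldOutside_torus (P : StepPieces T k) (N : ℕ → ℕ) [∀ j, NeZero (N j)]
    (act : T.Hist (k + 1) → ∀ j, (TreeLengthTorus.tsys 3 (N j)).Dom → T.Cfg (k + 1) → ℝ)
    (Ω : T.Hist (k + 1) → ∀ j, Finset (TreeLengthTorus.tcubeSys 3 (N j)).Cube) (ℓ : ℕ → ℝ)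
    (hL : 1 < L) (hM : 0 < M₁) (hC : 0 ≤ C)
    (hℓ : ∀ j ∈ Finset.Icc 1 k, ℓ j = L⁻¹ ^ (k - j))
    (hκ : kappa₀ (4 * 2 ^ 3) (2 * 3) ≤ κ)
    (h25 : ∀ (h : T.Hist (k + 1)), ∀ j ∈ Finset.Icc 1 k,
      B10.Bound25Printed ⟨(TreeLengthTorus.tsys 3 (N j)).Dom, T.Cfg (k + 1), (TreeLengthTorus.tsys 3 (N j)).dj,
        act h j⟩ ((CM * g * pg) ^ 2 * ℓ j ^ 4) κ C)
    (hcard : ∀ (h : T.Hist (k + 1)), ∀ j ∈ Finset.Icc 1 k,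
      (((Finset.univ : Finset (TreeLengthTorus.tcubeSys 3 (N j)).Cube) \ Ω h j).card : ℝ)
        ≤ (M₁ * ℓ j)⁻¹ ^ 3 * P.Zvol h)
    (hPold : ∀ (h : T.Hist (k + 1)) (U : T.Cfg (k + 1)),
      P.Pold h U = ∑ j ∈ Finset.Icc 1 k, ∑ X : (TreeLengthTorus.tsys 3 (N j)).Dom, act h j X U)
    (hPoldIn : ∀ (h : T.Hist (k + 1)) (U : T.Cfg (k + 1)),
      P.PoldIn h U = ∑ j ∈ Finset.Icc 1 k,
        ∑ X ∈ Finset.univ.filter (fun X : (TreeLengthTorus.tsys 3 (N j)).Dom =>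
          (TreeLengthTorus.tcubeSys 3 (N j)).cubes X ⊆ Ω h j), act h j X U) :
    OldOutside P (C * K₀ (4 * 2 ^ 3) (2 * 3) * CM ^ 2 * M₁⁻¹ ^ 3 * (L / (L - 1)) * (g * pg) ^ 2) :=
  oldOutside_of_allScales P (fun j => TreeLengthTorus.tsys 3 (N j)) (fun j => TreeLengthTorus.tcubeSys 3 (N j))
    act Ω ℓ hL hM hC hℓ (fun j _ => TreeLengthTorus.tdegreeLE 3 (N j)) (fun j _ => TreeLengthTorus.tvolumeLeaf 3 (N j))
    hκ h25 hcard hPold hPoldIn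

end Old

/-! ## §3 (36)/(41): `ZtermSucc` from the carrier's recursion, with a k-uniform majorant of the gathered constant -/

/-- **The Z-term leaf from the recursion**: if the carrier's Z-terms satisfy
`T.Zterm k (proj h) + CZ′·|Z_k|(h) ≤ T.Zterm (k+1) h` (e.g. DEFINED by `Zterm (k+1) h := Zterm k (proj h) + CZ′·|Z_k|(h)`,
the printed «Σ_{j=0}^{k} O(log g_j⁻¹)|Z_j|» of (41)_{k+1} built from that of (41)_k) and `CZ ≤ CZ′`, then
`ZtermSucc P CZ`. [cite: Balaban1985UV3, (41) p.266 + p.271] -/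
theorem ztermSucc_of_recursion (P : StepPieces T k) {CZ CZ' : ℝ}
    (hrec : ∀ h : T.Hist (k + 1), T.Zterm k (P.proj h) + CZ' * P.Zvol h ≤ T.Zterm (k + 1) h) (hle : CZ ≤ CZ') :
    ZtermSucc P CZ :=
  ztermSucc_mono (fun h => hrec h) hle

/-- **The gathered Z-constant has a k-UNIFORM majorant of the printed form «O(log g_k⁻¹)»**: with `0 < g_k ≤ 1`,
`|log σ₀| ≤ σmax`, `0 ≤ d(𝔤) ≤ dg`, `0 ≤ c₁`, `0 ≤ Cz + Cv`,
`(Cz + Cv)·g_k + C₅ + C₆ + (|log σ₀| + d(𝔤)·log g_k⁻¹)·c₁ ≤ (Cz + Cv + C₅ + C₆ + σmax·c₁) + (dg·c₁)·log g_k⁻¹`.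
(`B10SectAGathering.constants_complement` is where the log is born; here only its majorant.)
[cite: Balaban1985UV3, (36) p.265 + (41) p.266] -/
theorem gathered_le_majorant (P : StepPieces T k) {Cz Cv C₅ C₆ c₁ σmax dg : ℝ}
    (hg : 0 < T.g k) (hg1 : T.g k ≤ 1) (hσ : |P.logσ₀| ≤ σmax) (hdg : P.dg ≤ dg) (hc₁ : 0 ≤ c₁)
    (hCzv : 0 ≤ Cz + Cv) :
    (Cz + Cv) * T.g k + C₅ + C₆ + (|P.logσ₀| + P.dg * Real.log (T.g k)⁻¹) * c₁
      ≤ (Cz + Cv + C₅ + C₆ + σmax * c₁) + (dg * c₁) * Real.log (T.g k)⁻¹ := by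
  have hlog : 0 ≤ Real.log (T.g k)⁻¹ := by
    rw [Real.log_inv]
    have := Real.log_nonpos hg.le hg1
    linarith
  have h1 : (Cz + Cv) * T.g k ≤ Cz + Cv := by nlinarith
  have h2 : |P.logσ₀| * c₁ ≤ σmax * c₁ := mul_le_mul_of_nonneg_right hσ hc₁
  have h3 : P.dg * Real.log (T.g k)⁻¹ * c₁ ≤ dg * Real.log (T.g k)⁻¹ * c₁ :=
    mul_le_mul_of_nonneg_right (mul_le_mul_of_nonneg_right hdg hlog) hc₁
  nlinarith

/-- **`StepLeaves.ztermSucc` for a carrier that defines its Z-terms by the k-uniform recursion**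
`Zterm (k+1) h ≥ Zterm k (proj h) + (a + b·log g_k⁻¹)·|Z_k|(h)` with `a = Cz + Cv + C₅ + C₆ + σmax·c₁`, `b = dg·c₁`
(ONE pair (a, b) for the whole family — the printed «O(log g_j⁻¹)|Z_j|» of (41)): the leaf holds with the gathered
constant `(Cz + Cv)·g_k + C₅ + C₆ + (|log σ₀| + d(𝔤)·log g_k⁻¹)·c₁` that `B10SectAGathering.StepLeaves.ztermSucc` /
`ineq41_succ_of_leaves` require. [cite: Balaban1985UV3, (41) p.266 + p.271] -/
theorem ztermSucc_of_recursion_majorant (P : StepPieces T k) {Cz Cv C₅ C₆ c₁ σmax dg : ℝ}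
    (hg : 0 < T.g k) (hg1 : T.g k ≤ 1) (hσ : |P.logσ₀| ≤ σmax) (hdg : P.dg ≤ dg) (hc₁ : 0 ≤ c₁)
    (hCzv : 0 ≤ Cz + Cv)
    (hrec : ∀ h : T.Hist (k + 1), T.Zterm k (P.proj h)
      + ((Cz + Cv + C₅ + C₆ + σmax * c₁) + (dg * c₁) * Real.log (T.g k)⁻¹) * P.Zvol h ≤ T.Zterm (k + 1) h) :
    ZtermSucc P ((Cz + Cv) * T.g k + C₅ + C₆ + (|P.logσ₀| + P.dg * Real.log (T.g k)⁻¹) * c₁) :=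
  ztermSucc_of_recursion P hrec (gathered_le_majorant P hg hg1 hσ hdg hc₁ hCzv)

end Summit.QuantumFields.Balaban3D.Proofs
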